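import Summits.NavierStokesRegularity.FluidComputer.AngularGalerkinLadder

/-!
# The angular Galerkin ladder: the LINEAR-FLOW SECTOR of the Casimir cut (theorems only)

Cell `ns-blowup`, seat `ns-blowup-lean` (g10). LABEL: KERNEL typing hygiene for the vocabulary of
`FluidComputer/AngularGalerkinLadder.lean` (route `Theses/AngularGalerkinLadder.lean`). WHAT THIS IS
NOT: not Navier–Stokes evidence — kinematic identities about the rotation generators `angGen`, the
Casimir operator `casimir` and the band defect `bandDefect`; nothing is asserted about any rung
dynamics, no profile is constructed, no crux is touched.

## Content

§1 LINEAR FIELDS `u = T`, `T : ℝ³ →L[ℝ] ℝ³`. The generator is the commutator with the cross-product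
map `C_a = (e_a × ·)`: `angGen a T = C_a ∘ T − T ∘ C_a` (`angGen_clm`), so `casimir T` and every
`bandDefect L T` are again linear fields (`casimir_clm`).

§2 THE CASIMIR ON LINEAR FIELDS IN MATRIX FORM: for `u(x) = Mx`,
`casimir u (x) = (4M + 2Mᵀ − 2(tr M)·1) x` (`casimir_toEuclideanCLM`). Consequently the Casimir acts
as the scalar `0`, `2 = 1·2`, `6 = 2·3` on the three isotypes of linear fields — scalar (`M = λ·1`,
degree `j = 0`), antisymmetric (`M = [ω]_×`, rigid rotations, `j = 1`) and symmetric trace-free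
(pure strains, `j = 2`) — and `(𝒞 − 6)(𝒞 − 2)𝒞` kills every linear field:
`isBandLimited_two_toEuclideanCLM` / `isBandLimited_two_clm` (EVERY linear field is band-limited of
degree `≤ 2`), `isBandLimited_one_toEuclideanCLM_of_transpose_eq_neg` (rigid rotations are of degree
`≤ 1`), `isBandLimited_zero_toEuclideanCLM_scalar` (radial fields `x ↦ c x` are of degree `0`),
`not_isBandLimited_one_toEuclideanCLM_of_symm` (a non-zero symmetric trace-free strain is NOT of
degree `≤ 1`: `bandDefect 1` acts on it as `24`) and
`not_isBandLimited_zero_toEuclideanCLM_of_transpose_eq_neg` (a non-zero rotation is NOT of degree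
`0`: the Casimir acts on it as `2`). This is the kinematic content of the route sentence «rung 2
contains the restricted-Euler / linear-flow sector» (Vieillefosse 1984, Cantwell 1992: the velocity
gradient `A = ∇u` of a linear flow; tree file
`Literature/Analysis/FluidPDE/RestrictedEulerDynamics.lean`)
and a check of the sign and normalisation of `casimir` (`= −Σ_a J_a²`, eigenvalue `j(j+1)`) and of
the recursion `bandDefect (L+1) = (𝒞 − (L+1)(L+2)) ∘ bandDefect L`.

Companion file `AngularGalerkinLadderBasics.lean`: zero field, monotonicity in the level, linearity
of the cut on smooth fields.

Proofs: `fderiv` of a continuous linear map is itself (`ContinuousLinearMap.fderiv`); the matrix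
identity `−Σ_a [E_a,[E_a,M]] = 4M + 2Mᵀ − 2(tr M)1` (`E_a = [e_a]_×`, using `Σ_a E_a² = −2·1` and
`Σ_a E_a M E_a = Mᵀ − (tr M)1`) is checked entrywise (`Fin 3` case split + `ring`).

References: [cite: Vieillefosse1984] [cite: Cantwell1992] (restricted Euler = rung-two closure);
[cite: BullardGellman1954] (vector spherical harmonics, degrees `j = 0, 1, 2` of linear fields).
-/

noncomputable section

namespace Summit.NavierStokesRegularity.FluidComputer

open Set MeasureTheory Filter Topology Function Matrix
open scoped ContDiff RealInnerProductSpace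
open Literature.Analysis.FluidPDE

namespace AngularLadder


/-! ## §1 Linear fields: the generators are commutators with the cross-product map -/

/-- **The rotation generator on a linear field is the commutator with `e_a × ·`**:
for `T : ℝ³ →L[ℝ] ℝ³`, `(J_a T)(x) = e_a × (Tx) − T(e_a × x)`, i.e.
`J_a T = C_a ∘ T − T ∘ C_a` with `C_a = crossCLM (axis a)`. [folklore] -/
theorem angGen_clm (a : Fin 3) (T : EuclideanSpace ℝ (Fin 3) →L[ℝ] EuclideanSpace ℝ (Fin 3)) :
    angGen a (⇑T) = ⇑((crossCLM (axis a)).comp T - T.comp (crossCLM (axis a))) := by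
  funext x
  simp [angGen, ContinuousLinearMap.fderiv]

/-- **The Casimir of a linear field is linear**: `𝒞 T = −Σ_a [C_a, [C_a, T]]`. [folklore] -/
theorem casimir_clm (T : EuclideanSpace ℝ (Fin 3) →L[ℝ] EuclideanSpace ℝ (Fin 3)) :
    casimir (⇑T) = ⇑(-∑ a : Fin 3,
      ((crossCLM (axis a)).comp ((crossCLM (axis a)).comp T - T.comp (crossCLM (axis a))) -
        ((crossCLM (axis a)).comp T - T.comp (crossCLM (axis a))).comp (crossCLM (axis a)))) := by
  funext x
  simp only [casimir, angGen_clm, _root_.neg_apply, _root_.sum_apply]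

/-! ## §2 The Casimir on linear fields in matrix form: `𝒞(Mx) = (4M + 2Mᵀ − 2 tr M · 1)x` -/

/-- Components of the axis vectors: `(e_a)_i = δ_{ai}`. [folklore] -/
theorem axis_apply (a i : Fin 3) : axis a i = if i = a then 1 else 0 := by
  simp [axis, PiLp.single_apply]

/-- **The Casimir of the rotation action on LINEAR vector fields, in matrix form**: for
`u(x) = Mx` (`M : Matrix (Fin 3) (Fin 3) ℝ`, as the map `Matrix.toEuclideanCLM M`),
`𝒞u (x) = (4M + 2Mᵀ − 2(tr M)·1) x` — from `−Σ_a [E_a,[E_a,M]]` with `E_a = [e_a]_×`,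
`Σ_a E_a² = −2·1`, `Σ_a E_a M E_a = Mᵀ − (tr M)·1`. [folklore] -/
theorem casimir_toEuclideanCLM (M : Matrix (Fin 3) (Fin 3) ℝ) :
    casimir (⇑(Matrix.toEuclideanCLM (n := Fin 3) (𝕜 := ℝ) M)) =
      ⇑(Matrix.toEuclideanCLM (n := Fin 3) (𝕜 := ℝ)
        ((4 : ℝ) • M + (2 : ℝ) • Mᵀ - (2 * M.trace) • (1 : Matrix (Fin 3) (Fin 3) ℝ))) := by
  rw [casimir_clm]
  funext x
  apply PiLp.ext
  intro i
  simp only [Fin.sum_univ_three, Matrix.trace_fin_three]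
  fin_cases i <;>
    simp [cross, cross_apply, Matrix.ofLp_toEuclideanCLM, Matrix.mulVec, dotProduct,
      Fin.sum_univ_three, axis_apply, Matrix.transpose_apply] <;> ring


/-- **Band defect one on linear fields**: `(𝒞 − 2)𝒞 (Mx) = (12M + 12Mᵀ − 8(tr M)·1) x`.
[folklore] -/
theorem bandDefect_one_toEuclideanCLM (M : Matrix (Fin 3) (Fin 3) ℝ) :
    bandDefect 1 (⇑(Matrix.toEuclideanCLM (n := Fin 3) (𝕜 := ℝ) M)) =
      ⇑(Matrix.toEuclideanCLM (n := Fin 3) (𝕜 := ℝ)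
        ((12 : ℝ) • M + (12 : ℝ) • Mᵀ - (8 * M.trace) • (1 : Matrix (Fin 3) (Fin 3) ℝ))) := by
  funext x
  change casimir (bandDefect 0 ⇑(Matrix.toEuclideanCLM (n := Fin 3) (𝕜 := ℝ) M)) x -
      ((((0 : ℕ) : ℝ) + 1) * (((0 : ℕ) : ℝ) + 2)) •
        bandDefect 0 (⇑(Matrix.toEuclideanCLM (n := Fin 3) (𝕜 := ℝ) M)) x = _
  simp only [bandDefect, casimir_toEuclideanCLM]
  rw [← sub_eq_zero]
  apply PiLp.ext
  intro i
  simp only [Matrix.trace_fin_three]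
  fin_cases i <;>
    simp [Matrix.ofLp_toEuclideanCLM, Matrix.mulVec, dotProduct, Fin.sum_univ_three,
      Matrix.transpose_apply] <;> ring

/-- **Every linear field is band-limited of degree `≤ 2`**: `(𝒞 − 6)(𝒞 − 2)𝒞 (Mx) = 0` for every
`M : Matrix (Fin 3) (Fin 3) ℝ` — the linear fields are exactly the sum of the three isotypes
`j = 0` (scalar), `j = 1` (antisymmetric: rigid rotations) and `j = 2` (symmetric trace-free:
pure strains), the sector of the restricted-Euler dynamics of the velocity gradient. [folklore] -/
theorem bandDefect_two_toEuclideanCLM (M : Matrix (Fin 3) (Fin 3) ℝ) :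
    bandDefect 2 (⇑(Matrix.toEuclideanCLM (n := Fin 3) (𝕜 := ℝ) M)) = 0 := by
  funext x
  change casimir (bandDefect 1 ⇑(Matrix.toEuclideanCLM (n := Fin 3) (𝕜 := ℝ) M)) x -
      ((((1 : ℕ) : ℝ) + 1) * (((1 : ℕ) : ℝ) + 2)) •
        bandDefect 1 (⇑(Matrix.toEuclideanCLM (n := Fin 3) (𝕜 := ℝ) M)) x = 0
  simp only [bandDefect_one_toEuclideanCLM, casimir_toEuclideanCLM]
  apply PiLp.ext
  intro i
  simp only [Matrix.trace_fin_three]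
  fin_cases i <;>
    simp [Matrix.ofLp_toEuclideanCLM, Matrix.mulVec, dotProduct, Fin.sum_univ_three,
      Matrix.transpose_apply] <;> ring

/-- **Every linear field `x ↦ Mx` is band-limited of degree `≤ 2`** (rung two of the ladder
contains the whole linear-flow sector). [folklore] -/
theorem isBandLimited_two_toEuclideanCLM (M : Matrix (Fin 3) (Fin 3) ℝ) :
    IsBandLimited 2 (⇑(Matrix.toEuclideanCLM (n := Fin 3) (𝕜 := ℝ) M)) :=
  ⟨(Matrix.toEuclideanCLM (n := Fin 3) (𝕜 := ℝ) M).contDiff, fun x => by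
    rw [bandDefect_two_toEuclideanCLM]; rfl⟩

/-- **Every continuous linear field on `ℝ³` is band-limited of degree `≤ 2`** (coordinate-free
form of `isBandLimited_two_toEuclideanCLM`). [folklore] -/
theorem isBandLimited_two_clm (T : EuclideanSpace ℝ (Fin 3) →L[ℝ] EuclideanSpace ℝ (Fin 3)) :
    IsBandLimited 2 (⇑T) := by
  have hT : T = Matrix.toEuclideanCLM (n := Fin 3) (𝕜 := ℝ)
      ((Matrix.toEuclideanCLM (n := Fin 3) (𝕜 := ℝ)).symm T) :=
    ((Matrix.toEuclideanCLM (n := Fin 3) (𝕜 := ℝ)).apply_symm_apply T).symm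
  rw [hT]
  exact isBandLimited_two_toEuclideanCLM _

/-- An antisymmetric `3 × 3` matrix is trace-free. [folklore] -/
theorem trace_eq_zero_of_transpose_eq_neg {M : Matrix (Fin 3) (Fin 3) ℝ} (hM : Mᵀ = -M) :
    M.trace = 0 := by
  have h1 : Mᵀ.trace = M.trace := Matrix.trace_transpose M
  rw [hM, Matrix.trace_neg] at h1
  linarith

/-- **The Casimir acts as `2` on rigid rotations** (antisymmetric `M`, `x ↦ Mx = ω × x`):
`𝒞 (Mx) = 2 Mx` (isotype `j = 1`, `j(j+1) = 2`). [folklore] -/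
theorem casimir_toEuclideanCLM_of_transpose_eq_neg (M : Matrix (Fin 3) (Fin 3) ℝ)
    (hM : Mᵀ = -M) (x : EuclideanSpace ℝ (Fin 3)) :
    casimir (⇑(Matrix.toEuclideanCLM (n := Fin 3) (𝕜 := ℝ) M)) x =
      (2 : ℝ) • Matrix.toEuclideanCLM (n := Fin 3) (𝕜 := ℝ) M x := by
  have e : (4 : ℝ) • M + (2 : ℝ) • Mᵀ - (2 * M.trace) • (1 : Matrix (Fin 3) (Fin 3) ℝ) =
      (2 : ℝ) • M := by
    rw [hM, trace_eq_zero_of_transpose_eq_neg hM, mul_zero, zero_smul, sub_zero, smul_neg]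
    module
  rw [casimir_toEuclideanCLM, e, map_smul]
  rfl

/-- **Rigid rotations are band-limited of degree `≤ 1`**: for antisymmetric `M`,
`(𝒞 − 2)𝒞 (Mx) = 0`. [folklore] -/
theorem isBandLimited_one_toEuclideanCLM_of_transpose_eq_neg (M : Matrix (Fin 3) (Fin 3) ℝ)
    (hM : Mᵀ = -M) : IsBandLimited 1 (⇑(Matrix.toEuclideanCLM (n := Fin 3) (𝕜 := ℝ) M)) := by
  refine ⟨(Matrix.toEuclideanCLM (n := Fin 3) (𝕜 := ℝ) M).contDiff, fun x => ?_⟩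
  have e : (12 : ℝ) • M + (12 : ℝ) • Mᵀ - (8 * M.trace) • (1 : Matrix (Fin 3) (Fin 3) ℝ) = 0 := by
    rw [hM, trace_eq_zero_of_transpose_eq_neg hM, mul_zero, zero_smul, sub_zero, smul_neg,
      add_neg_cancel]
  rw [bandDefect_one_toEuclideanCLM, e, map_zero]
  rfl

/-- **The Casimir acts as `6` on pure strains** (symmetric trace-free `M`): `𝒞 (Mx) = 6 Mx`
(isotype `j = 2`, `j(j+1) = 6`). [folklore] -/
theorem casimir_toEuclideanCLM_of_symm (M : Matrix (Fin 3) (Fin 3) ℝ) (hM : Mᵀ = M)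
    (htr : M.trace = 0) (x : EuclideanSpace ℝ (Fin 3)) :
    casimir (⇑(Matrix.toEuclideanCLM (n := Fin 3) (𝕜 := ℝ) M)) x =
      (6 : ℝ) • Matrix.toEuclideanCLM (n := Fin 3) (𝕜 := ℝ) M x := by
  have e : (4 : ℝ) • M + (2 : ℝ) • Mᵀ - (2 * M.trace) • (1 : Matrix (Fin 3) (Fin 3) ℝ) =
      (6 : ℝ) • M := by
    rw [hM, htr, mul_zero, zero_smul, sub_zero]
    module
  rw [casimir_toEuclideanCLM, e, map_smul]
  rfl

/-- **Band defect one acts as `24` on pure strains** (symmetric trace-free `M`):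
`(𝒞 − 2)𝒞 (Mx) = (6 − 2)·6 · Mx = 24 Mx`. [folklore] -/
theorem bandDefect_one_toEuclideanCLM_of_symm (M : Matrix (Fin 3) (Fin 3) ℝ) (hM : Mᵀ = M)
    (htr : M.trace = 0) (x : EuclideanSpace ℝ (Fin 3)) :
    bandDefect 1 (⇑(Matrix.toEuclideanCLM (n := Fin 3) (𝕜 := ℝ) M)) x =
      (24 : ℝ) • Matrix.toEuclideanCLM (n := Fin 3) (𝕜 := ℝ) M x := by
  have e : (12 : ℝ) • M + (12 : ℝ) • Mᵀ - (8 * M.trace) • (1 : Matrix (Fin 3) (Fin 3) ℝ) =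
      (24 : ℝ) • M := by
    rw [hM, htr, mul_zero, zero_smul, sub_zero]
    module
  rw [bandDefect_one_toEuclideanCLM, e, map_smul]
  rfl

/-- **The scalar (radial) linear fields `x ↦ c x` are band-limited of degree `0`** (isotype
`j = 0`: `𝒞 (c x) = 0`). [folklore] -/
theorem isBandLimited_zero_toEuclideanCLM_scalar (c : ℝ) :
    IsBandLimited 0 (⇑(Matrix.toEuclideanCLM (n := Fin 3) (𝕜 := ℝ)
      (c • (1 : Matrix (Fin 3) (Fin 3) ℝ)))) := by
  refine ⟨(Matrix.toEuclideanCLM (n := Fin 3) (𝕜 := ℝ) _).contDiff, fun x => ?_⟩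
  have e : (4 : ℝ) • (c • (1 : Matrix (Fin 3) (Fin 3) ℝ)) +
      (2 : ℝ) • (c • (1 : Matrix (Fin 3) (Fin 3) ℝ))ᵀ -
      (2 * (c • (1 : Matrix (Fin 3) (Fin 3) ℝ)).trace) • (1 : Matrix (Fin 3) (Fin 3) ℝ) = 0 := by
    rw [Matrix.transpose_smul, Matrix.transpose_one, Matrix.trace_smul, Matrix.trace_one,
      Fintype.card_fin, smul_eq_mul]
    norm_num
    module
  change casimir _ x = 0
  rw [casimir_toEuclideanCLM, e, map_zero]
  rfl

/-- A linear field that vanishes identically has zero matrix. [folklore] -/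
theorem matrix_eq_zero_of_toEuclideanCLM_apply_eq_zero {M : Matrix (Fin 3) (Fin 3) ℝ}
    (h : ∀ x : EuclideanSpace ℝ (Fin 3), Matrix.toEuclideanCLM (n := Fin 3) (𝕜 := ℝ) M x = 0) :
    M = 0 := by
  have hE : Matrix.toEuclideanCLM (n := Fin 3) (𝕜 := ℝ) M = 0 := ContinuousLinearMap.ext h
  exact (map_eq_zero_iff _ (Matrix.toEuclideanCLM (n := Fin 3) (𝕜 := ℝ)).injective).1 hE

/-- **A non-zero pure strain is NOT band-limited of degree `≤ 1`**: for symmetric trace-free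
`M ≠ 0`, `(𝒞 − 2)𝒞 (Mx) = 24 Mx ≢ 0` — the strain sector first appears at rung TWO. [folklore] -/
theorem not_isBandLimited_one_toEuclideanCLM_of_symm (M : Matrix (Fin 3) (Fin 3) ℝ) (hM : Mᵀ = M)
    (htr : M.trace = 0) (hM0 : M ≠ 0) :
    ¬ IsBandLimited 1 (⇑(Matrix.toEuclideanCLM (n := Fin 3) (𝕜 := ℝ) M)) := by
  rintro ⟨-, h⟩
  refine hM0 (matrix_eq_zero_of_toEuclideanCLM_apply_eq_zero fun x => ?_)
  have hx := h x
  rw [bandDefect_one_toEuclideanCLM_of_symm M hM htr x] at hx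
  exact (smul_eq_zero.1 hx).resolve_left (by norm_num)

/-- **A non-zero rigid rotation is NOT band-limited of degree `0`**: for antisymmetric `M ≠ 0`,
`𝒞 (Mx) = 2 Mx ≢ 0` — rotations first appear at rung ONE. [folklore] -/
theorem not_isBandLimited_zero_toEuclideanCLM_of_transpose_eq_neg (M : Matrix (Fin 3) (Fin 3) ℝ)
    (hM : Mᵀ = -M) (hM0 : M ≠ 0) :
    ¬ IsBandLimited 0 (⇑(Matrix.toEuclideanCLM (n := Fin 3) (𝕜 := ℝ) M)) := by
  rintro ⟨-, h⟩
  refine hM0 (matrix_eq_zero_of_toEuclideanCLM_apply_eq_zero fun x => ?_)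
  have hx : casimir _ x = 0 := h x
  rw [casimir_toEuclideanCLM_of_transpose_eq_neg M hM x] at hx
  exact (smul_eq_zero.1 hx).resolve_left (by norm_num)

end AngularLadder

end Summit.NavierStokesRegularity.FluidComputer

end
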